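import Literature.Computability.AlgebraicComplexity.ArithCircuit
import Mathlib.RingTheory.MvPolynomial.Symmetric.Defs
import Mathlib.Data.Complex.Basic
import HarnessLib

/-!
# Bläser–Jindal: the circuit complexity of the witness of a symmetric polynomial (named fact)

Topic `Computability/AlgebraicComplexity`, namespace `Literature.Computability.AlgebraicComplexity`.

M. Bläser, G. Jindal, *On the Complexity of Symmetric Polynomials*, 10th Innovations in Theoretical
Computer Science (ITCS 2019), LIPIcs 124, 47:1–47:14 (doi:10.4230/LIPIcs.ITCS.2019.47; held text
`paper:doi-10-22028-d291-47561`). By the fundamental theorem of symmetric polynomials every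
symmetric `f_Sym ∈ ℂ[x_1, …, x_n]^{S_n}` is `f(e_1, …, e_n)` for a unique WITNESS `f`, where
`e_1, …, e_n` are the elementary symmetric polynomials. Abstract: "we study the arithmetic
complexity `L(f)` of the witness `f` as a function of the arithmetic complexity `L(f_Sym)` of
`f_Sym`. We show that the arithmetic complexity `L(f)` of `f` is bounded by
`poly(L(f_Sym), deg(f), n)`." Precisely, **Theorem 4** (p. 47:3): for `f ∈ ℂ[x_1, …, x_n]` of degree
`d` with `d_Sym = deg(f_Sym)`, `L_{f_Sym}(f) ≤ Õ(n³ d² d_Sym)` and `L(f) ≤ Õ(d² L(f_Sym) + d² n²)`,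
and the Remark after it: "`d_Sym ≤ d n` and `d ≤ d_Sym`" — so `L(f) ≤ poly(L(f_Sym), deg(f_Sym), n)`.
Proof in the paper (§4): Newton iteration for the implicit function `B(y) = Π_i (y − x_i)` to
compute the power-series roots, then substitution into a circuit for `f_Sym` and truncation.

* `BlaserJindal2019_thm4` — the POLYNOMIAL FORM of Theorem 4 with the Remark (the abstract's
  statement), in the tree's vocabulary: `complexity` (`ArithCircuit.lean`, Bürgisser's fan-in-two
  `L` up to a factor `≤ 3`), Mathlib's `MvPolynomial.esymm`, witness `f : MvPolynomial (Fin n) ℂ`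
  and `f_Sym = MvPolynomial.aeval (fun i => esymm (Fin n) ℂ (i + 1)) f` (the numbering
  `e_1, …, e_n` of `MvPolynomial.esymmAlgHom`). Named fact (not proved here).
  -- TODO(general form): the paper's bound carries only polylogarithmic overhead,
  -- `L(f) ≤ Õ(d² L(f_Sym) + d² n²)`; the polynomial form below is what route MonotoneRestoration
  -- (summit ValiantsHypothesis) consumes.

Consumed by `Summits/ValiantsHypothesis/ValiantsHypothesis/Theorems/…QPZetaEntrySymmetric.lean`: with
THEOREM ζ-G of that route (programs on symmetrically computed invariant generators are symmetric
circuits) it shows that `VP` families symmetric in ALL `n²` matrix entries have polynomial-size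
square-symmetric circuits — the reflection-group regime of the crux `MonotoneRestorationQP`.
-/

noncomputable section

namespace Literature.Computability.AlgebraicComplexity

/-- **Bläser–Jindal 2019, Theorem 4 (polynomial form, with the Remark `deg f ≤ deg f_Sym`).**
There is an absolute exponent `c` such that for every `n` and every `f ∈ ℂ[y_1, …, y_n]`, writing
`f_Sym = f(e_1, …, e_n)` (`e_k` the elementary symmetric polynomials in `x_1, …, x_n`):
`L(f) ≤ (L(f_Sym) + deg(f_Sym) + n + 2)^c`. Named fact.
[cite: BlaserJindal2019, Thm. 4 and Remark (p. 47:3); abstract] -/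
def BlaserJindal2019_thm4 : Prop :=
  ∃ c : ℕ, ∀ (n : ℕ) (f : MvPolynomial (Fin n) ℂ),
    complexity f ≤
      (complexity (MvPolynomial.aeval (fun i : Fin n => MvPolynomial.esymm (Fin n) ℂ (i + 1)) f) +
        (MvPolynomial.aeval (fun i : Fin n => MvPolynomial.esymm (Fin n) ℂ (i + 1)) f).totalDegree +
          n + 2) ^ c

end Literature.Computability.AlgebraicComplexity

end
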